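import Summits.ValiantsHypothesis.ValiantsHypothesis.Theorems.KPlusLogSqLawTridiagonalRealStatic
import Summits.ValiantsHypothesis.ValiantsHypothesis.Theorems.LacunarySymmetroidMatrixDescartesInertiaKit

/-!
# Route «KPlusLogSqLaw», crux `WeakLifting` (stmt-ValiantsHypothesis-19561) — REAL side of the tridiagonal sector:
# the JACOBI–STURM SIGNATURE RULE for symmetric tridiagonal (path) matrices — the inertia IS the number of sign changes of the
# leading continuants

HONEST FRAMING.  Helper (`--supports stmt-ValiantsHypothesis-19561 --as helper`), seat val-sym-lift-p2 (g15), cell `pub-symmetroid`, 2026-08-28;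
a KERNEL BRIDGE between the two currencies in which the cell keeps its α register (static definite symmetric tridiagonal row `B m`): the
CONTINUANT currency of the lift lineage (`ValuativeFlip.ctPath` / `ctK`, `pathDet`; every certificate of the register is a sign table of continuants
at rational points) and the INERTIA currency of val-sym-mdr-p2's kit (`ν(A) = card {j // hA.eigenvalues j < 0}`, `π(A) = card {j // 0 < hA.eigenvalues j}`:
index formula, parity, windows, one-type laws).  Classical linear algebra, all sizes; no count law for the register is claimed.  Nothing here bears
on `WeakLifting` / `TropicalB` (stmt-19771) in their windows, on Conjecture B, on the Door-A registers, on `MatrixDescartes` (stmt-ValiantsHypothesis-18050)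
or on VP ≠ VNP.

OBJECTS (no definitions).  For `L M : ℕ → ℝ` the SYMMETRIC PATH MATRIX `T_m = ctPath L M (fun t => M (t − 1)) m` (diagonal `L`, links `M`; the
matrix whose determinant, for monomial data, is the lineage's `pathDet`), its leading continuants `Δ_k = ctK L (−M) (fun t => M (t − 1)) k = det T_k`
(`Δ₀ = 1`, `Δ₁ = L 0`, `Δ_{k+2} = L (k+1) Δ_{k+1} − (M k)² Δ_k`; tree `det_ctPath`), and — as a bound variable `p` with the defining hypothesis
`p k · Δ_k = Δ_{k+1}` — the PIVOTS `p_k = Δ_{k+1}/Δ_k`.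

WHAT IS PROVED (all `m`; hypothesis: NO leading continuant vanishes, `Δ_k ≠ 0` for `k ≤ m`).
* `ctPathSymm_eq_mul` — the explicit `UᵀDU` FACTORISATION `T_m = Uᵀ · diagonal(p) · U`, `U` unit upper bidiagonal with `U_{k,k+1} = M k / p k`;
  `det_upperUnit_eq_one`; `form_eq_sum_pivots` — for `v = U⁻¹ c`: `vᵀ T_m v = Σ_k p_k c_k²`.
* **`negIndex_eq_card_negPivots` / `posIndex_eq_card_posPivots` — JACOBI'S RULE: `ν(T_m) = #{k < m : p_k < 0}`, `π(T_m) = #{k < m : 0 < p_k}`**,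
  and in sign-change form **`negIndex_eq_card_signChanges` / `negIndex_eq_card_signChanges'`: `ν(T_m) = #{k < m : Δ_k · Δ_{k+1} < 0}`** (the primed
  form assumes only `Δ_k ≠ 0`, `k ≤ m`; Sylvester's law in the family language of the kit: `card_le_negIndex`, `card_le_posIndex`,
  `negIndex_add_posIndex_add_corank`).
READING for the register (located data in the seat memo): at `x > 0` with no vanishing leading continuant, the negative inertia index of a
static definite tridiagonal pencil is the number of sign changes along `(D_0(x), …, D_m(x))`, so the kit's index formula
`#roots = |Δν| + 2·min(N⁻, N⁺)` and window laws apply with `ν` READ OFF CONTINUANT SIGN TABLES; `…WronskianLinks.x_mul_derivative_mul_eval_of_root`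
names the type of each root.
[folklore: Jacobi's signature rule / Sylvester's law of inertia / Sturm sequences for Jacobi matrices]
-/

set_option linter.dupNamespace false
set_option autoImplicit false

namespace Summit.ValiantsHypothesis.ValiantsHypothesis.Theorems.KPlusLogSqLaw

namespace SturmJacobi

open Matrix Finset
open scoped BigOperators
open Summit.ValiantsHypothesis.ValiantsHypothesis.Theorems.ValuativeFlip (ctK ctPath ctPath_apply ctK_zero ctK_one ctK_add_two)
open Summit.ValiantsHypothesis.ValiantsHypothesis.Theorems.KPlusLogSqLaw.StaticTridiagonalReal (det_ctPath)
open Summit.ValiantsHypothesis.ValiantsHypothesis.Theorems.LacunarySymmetroidMatrixDescartes.Inertia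
  (card_le_negIndex card_le_posIndex negIndex_add_posIndex_add_corank corank_eq_zero_of_det_ne_zero)

variable (L M : ℕ → ℝ)

/-! ## 1. The symmetric path matrix and its leading continuants -/
/-- Entry formula of the symmetric path matrix. [folklore] -/
theorem ctPathSymm_apply (m : ℕ) (i j : Fin m) :
    ctPath L M (fun t => M (t - 1)) m i j =
      if (j : ℕ) = i then L i else if (j : ℕ) = i + 1 then M i else if (i : ℕ) = j + 1 then M j else 0 := by
  rw [ctPath_apply]
  by_cases h1 : (j : ℕ) = i
  · rw [if_pos h1, if_pos h1]
  · rw [if_neg h1, if_neg h1]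
    by_cases h2 : (j : ℕ) = i + 1
    · rw [if_pos h2, if_pos h2]
    · rw [if_neg h2, if_neg h2]
      by_cases h3 : (i : ℕ) = j + 1
      · rw [if_pos h3, if_pos h3, h3, Nat.add_sub_cancel]
      · rw [if_neg h3, if_neg h3]

/-- The symmetric path matrix is symmetric. [folklore] -/
theorem ctPathSymm_isSymm (m : ℕ) : (ctPath L M (fun t => M (t - 1)) m).IsSymm := by
  refine Matrix.IsSymm.ext fun i j => ?_
  rw [ctPathSymm_apply, ctPathSymm_apply]
  have hi := i.isLt; have hj := j.isLt
  by_cases h1 : (i : ℕ) = j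
  · rw [if_pos h1, if_pos h1.symm, Fin.ext h1]
  · rw [if_neg h1, if_neg (Ne.symm h1)]
    by_cases h2 : (i : ℕ) = j + 1
    · rw [if_pos h2, if_neg (by omega), if_pos h2]
    · rw [if_neg h2, if_neg h2]

/-- The symmetric path matrix is hermitian (real symmetric). [folklore] -/
theorem ctPathSymm_isHermitian (m : ℕ) : (ctPath L M (fun t => M (t - 1)) m).IsHermitian := by
  unfold Matrix.IsHermitian
  rw [Matrix.conjTranspose_eq_transpose_of_trivial]
  exact ctPathSymm_isSymm L M m

/-- **Recurrence of the leading continuants**: `Δ_{k+2} = L (k+1) Δ_{k+1} − (M k)² Δ_k`. [folklore] -/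
theorem delta_add_two (k : ℕ) :
    ctK L (fun t => -M t) (fun t => M (t - 1)) (k + 2) =
      L (k + 1) * ctK L (fun t => -M t) (fun t => M (t - 1)) (k + 1) - M k ^ 2 * ctK L (fun t => -M t) (fun t => M (t - 1)) k := by
  rw [ctK_add_two]
  simp only [Nat.add_sub_cancel]
  ring

/-- `det T_k = Δ_k`. [folklore: tree `det_ctPath`] -/
theorem det_ctPathSymm (k : ℕ) : (ctPath L M (fun t => M (t - 1)) k).det = ctK L (fun t => -M t) (fun t => M (t - 1)) k :=
  det_ctPath L M (fun t => M (t - 1)) k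

/-! ## 2. The `UᵀDU` factorisation -/
section Factor

variable (m : ℕ) (p : ℕ → ℝ)
  (hΔ : ∀ k, k ≤ m → ctK L (fun t => -M t) (fun t => M (t - 1)) k ≠ 0)
  (hp : ∀ k, k < m → p k * ctK L (fun t => -M t) (fun t => M (t - 1)) k = ctK L (fun t => -M t) (fun t => M (t - 1)) (k + 1))
include hΔ hp

/-- Pivots are nonzero. [bookkeeping] -/
theorem pivot_ne_zero (k : ℕ) (hk : k < m) : p k ≠ 0 := fun h =>
  hΔ (k + 1) hk (by have := hp k hk; rw [h, zero_mul] at this; exact this.symm)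

omit hΔ in
/-- `p 0 = L 0`. [bookkeeping] -/
theorem pivot_zero (hm : 0 < m) : p 0 = L 0 := by simpa [ctK_zero, ctK_one] using hp 0 hm

/-- **Pivot recurrence**: `p_{k+1} = L (k+1) − (M k)² / p_k`. [folklore] -/
theorem pivot_succ (k : ℕ) (hk : k + 1 < m) : p (k + 1) = L (k + 1) - M k ^ 2 / p k := by
  have h0 := hΔ k (by omega)
  have h1 := hΔ (k + 1) (by omega)
  have e0 := hp k (by omega)
  have e1 := hp (k + 1) hk
  have hpk := pivot_ne_zero L M m p hΔ hp k (by omega)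
  rw [delta_add_two] at e1
  have : p (k + 1) = L (k + 1) - M k ^ 2 * (ctK L (fun t => -M t) (fun t => M (t - 1)) k /
      ctK L (fun t => -M t) (fun t => M (t - 1)) (k + 1)) := by
    field_simp
    linear_combination e1
  rw [this, ← e0]
  field_simp

/-- **THE `UᵀDU` FACTORISATION** of the symmetric path matrix: with pivots `p` and the unit upper bidiagonal `U` (`U_{k,k} = 1`,
`U_{k,k+1} = M k / p k`), `T_m = Uᵀ · diagonal p · U`. [folklore: LDLᵀ of a Jacobi matrix] -/
theorem ctPathSymm_eq_mul :
    ctPath L M (fun t => M (t - 1)) m =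
      (Matrix.of fun i j : Fin m => if (j : ℕ) = i then (1 : ℝ) else if (j : ℕ) = i + 1 then M i / p i else 0)ᵀ *
      (Matrix.diagonal (fun i : Fin m => p i) *
        Matrix.of fun i j : Fin m => if (j : ℕ) = i then (1 : ℝ) else if (j : ℕ) = i + 1 then M i / p i else 0) := by
  -- the product `diagonal p * U` is the upper bidiagonal `V` with `V_{k,k} = p k`, `V_{k,k+1} = M k`
  have hV : ∀ k j : Fin m, (Matrix.diagonal (fun i : Fin m => p i) *
      (Matrix.of fun i j : Fin m => if (j : ℕ) = i then (1 : ℝ) else if (j : ℕ) = i + 1 then M i / p i else 0)) k j =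
      if (j : ℕ) = k then p k else if (j : ℕ) = k + 1 then M k else 0 := by
    intro k j
    rw [Matrix.diagonal_mul]
    simp only [Matrix.of_apply]
    by_cases h1 : (j : ℕ) = k
    · rw [if_pos h1, if_pos h1, mul_one]
    · rw [if_neg h1, if_neg h1]
      by_cases h2 : (j : ℕ) = k + 1
      · rw [if_pos h2, if_pos h2, mul_div_cancel₀ _ (pivot_ne_zero L M m p hΔ hp k k.isLt)]
      · rw [if_neg h2, if_neg h2, mul_zero]
  ext i j
  rw [Matrix.mul_apply]
  simp only [Matrix.transpose_apply]
  simp_rw [hV]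
  simp only [Matrix.of_apply]
  have hi := i.isLt
  have hj := j.isLt
  by_cases hi0 : (i : ℕ) = 0
  · -- first row: only the term `k = i` survives
    rw [Fintype.sum_eq_single i (fun k hk => by
      have hki : (k : ℕ) ≠ i := fun h => hk (Fin.ext h)
      rw [if_neg (Ne.symm hki), if_neg (by omega), zero_mul])]
    rw [if_pos rfl, one_mul, ctPath_apply]
    by_cases h1 : (j : ℕ) = i
    · rw [if_pos h1, if_pos h1]
      have h0 : (i : ℕ) = 0 := hi0
      rw [show L (i : ℕ) = L 0 by rw [h0], show p (i : ℕ) = p 0 by rw [h0]]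
      exact (pivot_zero L M m p hp (by omega)).symm
    · rw [if_neg h1, if_neg h1]
      by_cases h2 : (j : ℕ) = i + 1
      · rw [if_pos h2, if_pos h2]
      · rw [if_neg h2, if_neg h2, if_neg (by omega)]
  · -- rows `i ≥ 1`: the terms `k = i` and `k = i - 1`
    have hi1 : 1 ≤ (i : ℕ) := Nat.one_le_iff_ne_zero.mpr hi0
    let i' : Fin m := ⟨(i : ℕ) - 1, by omega⟩
    have hi'v : ((i' : Fin m) : ℕ) = (i : ℕ) - 1 := rfl
    have hii' : i ≠ i' := by
      intro h; have := congrArg Fin.val h; rw [hi'v] at this; omega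
    rw [Fintype.sum_eq_add i i' hii' (fun k hk => by
      have hki : (k : ℕ) ≠ i := fun h => hk.1 (Fin.ext h)
      have hki' : (k : ℕ) ≠ (i : ℕ) - 1 := fun h => hk.2 (Fin.ext (by rw [hi'v]; exact h))
      rw [if_neg (Ne.symm hki), if_neg (by omega), zero_mul])]
    rw [if_pos rfl, one_mul, hi'v, if_neg (show ¬ ((i : ℕ) = (i : ℕ) - 1) by omega),
      if_pos (show (i : ℕ) = (i : ℕ) - 1 + 1 by omega), ctPath_apply]
    by_cases h1 : (j : ℕ) = i
    · -- diagonal entry: the pivot recurrence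
      rw [if_pos h1, if_pos h1, if_neg (by omega), if_pos (by omega)]
      have hrec := pivot_succ L M m p hΔ hp ((i : ℕ) - 1) (by omega)
      rw [show (i : ℕ) - 1 + 1 = (i : ℕ) by omega] at hrec
      have hp' : p ((i : ℕ) - 1) ≠ 0 := pivot_ne_zero L M m p hΔ hp _ (by omega)
      rw [hrec]
      field_simp
      ring
    · rw [if_neg h1, if_neg h1]
      by_cases h2 : (j : ℕ) = i + 1
      · rw [if_pos h2, if_pos h2, if_neg (by omega), if_neg (by omega), mul_zero, add_zero]
      · rw [if_neg h2, if_neg h2]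
        by_cases h3 : (i : ℕ) = j + 1
        · rw [if_pos h3, if_pos (by omega), zero_add]
          have hp' : p ((i : ℕ) - 1) ≠ 0 := pivot_ne_zero L M m p hΔ hp _ (by omega)
          rw [div_mul_cancel₀ _ hp', h3, Nat.add_sub_cancel]
        · rw [if_neg h3, if_neg (by omega), if_neg (by omega), mul_zero, add_zero]

omit hΔ hp in
/-- The unit upper bidiagonal factor has determinant `1`. [folklore] -/
theorem det_upperUnit_eq_one :
    (Matrix.of fun i j : Fin m => if (j : ℕ) = i then (1 : ℝ) else if (j : ℕ) = i + 1 then M i / p i else 0).det = 1 := by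
  rw [Matrix.det_of_upperTriangular]
  · simp [Matrix.of_apply]
  · intro i j hij
    simp only [Matrix.of_apply]
    have h : (j : ℕ) < i := hij
    rw [if_neg (by omega), if_neg (by omega)]

/-- **The form is diagonal in `U`-coordinates**: for every `c`, with `v = U⁻¹ c`, `vᵀ T_m v = Σ_k p_k c_k²`. [folklore: Sylvester] -/
theorem form_eq_sum_pivots (c : Fin m → ℝ) :
    ((Matrix.of fun i j : Fin m => if (j : ℕ) = i then (1 : ℝ) else if (j : ℕ) = i + 1 then M i / p i else 0)⁻¹ *ᵥ c) ⬝ᵥ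
      (ctPath L M (fun t => M (t - 1)) m *ᵥ
        ((Matrix.of fun i j : Fin m => if (j : ℕ) = i then (1 : ℝ) else if (j : ℕ) = i + 1 then M i / p i else 0)⁻¹ *ᵥ c)) =
      ∑ k : Fin m, p k * c k ^ 2 := by
  set U : Matrix (Fin m) (Fin m) ℝ :=
    Matrix.of fun i j : Fin m => if (j : ℕ) = i then (1 : ℝ) else if (j : ℕ) = i + 1 then M i / p i else 0 with hU
  have hdet : IsUnit U.det := by rw [hU, det_upperUnit_eq_one M m p]; exact isUnit_one
  have hUU : U * U⁻¹ = 1 := Matrix.mul_nonsing_inv U hdet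
  have hc : U *ᵥ (U⁻¹ *ᵥ c) = c := by rw [Matrix.mulVec_mulVec, hUU, Matrix.one_mulVec]
  rw [ctPathSymm_eq_mul L M m p hΔ hp, ← hU]
  rw [← Matrix.mulVec_mulVec, ← Matrix.mulVec_mulVec, hc, Matrix.dotProduct_mulVec, Matrix.vecMul_transpose, hc]
  simp only [dotProduct, Matrix.mulVec_diagonal]
  refine Finset.sum_congr rfl fun k _ => ?_
  ring

/-! ## 3. Jacobi's rule -/
/-- **`#negative pivots ≤ ν(T_m)`**: the `U⁻¹`-images of the coordinate vectors of the negative pivots form a negative family.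
[folklore: Sylvester] -/
theorem card_negPivots_le_negIndex :
    Fintype.card {k : Fin m // p k < 0} ≤ Fintype.card {j // (ctPathSymm_isHermitian L M m).eigenvalues j < 0} := by
  classical
  set U : Matrix (Fin m) (Fin m) ℝ :=
    Matrix.of fun i j : Fin m => if (j : ℕ) = i then (1 : ℝ) else if (j : ℕ) = i + 1 then M i / p i else 0 with hU
  let v : {k : Fin m // p k < 0} → Fin m → ℝ := fun a => U⁻¹ *ᵥ Pi.single (a : Fin m) 1
  refine card_le_negIndex (ctPathSymm_isHermitian L M m) v fun c hc => ?_
  -- the combination is `U⁻¹ ĉ` with `ĉ` the zero-extension of `c`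
  let ch : Fin m → ℝ := fun k => if h : p k < 0 then c ⟨k, h⟩ else 0
  have hcomb : (∑ a, c a • v a) = U⁻¹ *ᵥ ch := by
    have h1 : (∑ a, c a • v a) = U⁻¹ *ᵥ (∑ a : {k : Fin m // p k < 0}, c a • Pi.single (a : Fin m) (1 : ℝ)) := by
      rw [Matrix.mulVec_sum]
      refine Finset.sum_congr rfl fun a _ => ?_
      rw [Matrix.mulVec_smul]
    rw [h1]
    congr 1
    ext k
    simp only [Finset.sum_apply, Pi.smul_apply, Pi.single_apply, smul_eq_mul, mul_ite, mul_one, mul_zero]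
    by_cases hk : p k < 0
    · rw [Finset.sum_eq_single ⟨k, hk⟩]
      · simp [ch, hk]
      · intro a _ ha
        rw [if_neg]
        intro h
        exact ha (Subtype.ext h.symm)
      · intro h; exact absurd (Finset.mem_univ _) h
    · have : ch k = 0 := by simp [ch, hk]
      rw [this]
      refine Finset.sum_eq_zero fun a _ => ?_
      rw [if_neg]
      intro h
      exact hk (h ▸ a.2)
  rw [hcomb, hU, form_eq_sum_pivots L M m p hΔ hp ch]
  -- `Σ p_k ĉ_k² < 0`: all terms ≤ 0 and one is < 0
  obtain ⟨a, ha⟩ : ∃ a, c a ≠ 0 := by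
    by_contra h
    exact hc (funext fun a => by by_contra h'; exact h ⟨a, h'⟩)
  have hterm : ∀ k : Fin m, p k * ch k ^ 2 ≤ 0 := by
    intro k
    by_cases hk : p k < 0
    · exact mul_nonpos_of_nonpos_of_nonneg hk.le (sq_nonneg _)
    · have : ch k = 0 := by simp [ch, hk]
      rw [this]; simp
  have ha' : p a * ch a ^ 2 < 0 := by
    have hpa : p a < 0 := a.2
    have hcha : ch a = c a := by simp [ch, hpa]
    rw [hcha]
    exact mul_neg_of_neg_of_pos hpa (pow_pos (abs_pos.mpr ha) 2 |>.trans_eq (sq_abs _))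
  have hsplit := Finset.add_sum_erase Finset.univ (fun k : Fin m => p k * ch k ^ 2) (Finset.mem_univ (a : Fin m))
  have hrest := Finset.sum_nonpos fun k (_ : k ∈ Finset.univ.erase (a : Fin m)) => hterm k
  linarith

/-- **`#positive pivots ≤ π(T_m)`**. [folklore: Sylvester] -/
theorem card_posPivots_le_posIndex :
    Fintype.card {k : Fin m // 0 < p k} ≤ Fintype.card {j // 0 < (ctPathSymm_isHermitian L M m).eigenvalues j} := by
  classical
  set U : Matrix (Fin m) (Fin m) ℝ :=
    Matrix.of fun i j : Fin m => if (j : ℕ) = i then (1 : ℝ) else if (j : ℕ) = i + 1 then M i / p i else 0 with hU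
  let v : {k : Fin m // 0 < p k} → Fin m → ℝ := fun a => U⁻¹ *ᵥ Pi.single (a : Fin m) 1
  refine card_le_posIndex (ctPathSymm_isHermitian L M m) v fun c hc => ?_
  let ch : Fin m → ℝ := fun k => if h : 0 < p k then c ⟨k, h⟩ else 0
  have hcomb : (∑ a, c a • v a) = U⁻¹ *ᵥ ch := by
    have h1 : (∑ a, c a • v a) = U⁻¹ *ᵥ (∑ a : {k : Fin m // 0 < p k}, c a • Pi.single (a : Fin m) (1 : ℝ)) := by
      rw [Matrix.mulVec_sum]
      refine Finset.sum_congr rfl fun a _ => ?_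
      rw [Matrix.mulVec_smul]
    rw [h1]
    congr 1
    ext k
    simp only [Finset.sum_apply, Pi.smul_apply, Pi.single_apply, smul_eq_mul, mul_ite, mul_one, mul_zero]
    by_cases hk : 0 < p k
    · rw [Finset.sum_eq_single ⟨k, hk⟩]
      · simp [ch, hk]
      · intro a _ ha
        rw [if_neg]
        intro h
        exact ha (Subtype.ext h.symm)
      · intro h; exact absurd (Finset.mem_univ _) h
    · have : ch k = 0 := by simp [ch, hk]
      rw [this]
      refine Finset.sum_eq_zero fun a _ => ?_
      rw [if_neg]
      intro h
      exact hk (h ▸ a.2)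
  rw [hcomb, hU, form_eq_sum_pivots L M m p hΔ hp ch]
  obtain ⟨a, ha⟩ : ∃ a, c a ≠ 0 := by
    by_contra h
    exact hc (funext fun a => by by_contra h'; exact h ⟨a, h'⟩)
  have hterm : ∀ k : Fin m, 0 ≤ p k * ch k ^ 2 := by
    intro k
    by_cases hk : 0 < p k
    · exact mul_nonneg hk.le (sq_nonneg _)
    · have : ch k = 0 := by simp [ch, hk]
      rw [this]; simp
  have ha' : 0 < p a * ch a ^ 2 := by
    have hpa : 0 < p a := a.2
    have hcha : ch a = c a := by simp [ch, hpa]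
    rw [hcha]
    exact mul_pos hpa (pow_pos (abs_pos.mpr ha) 2 |>.trans_eq (sq_abs _))
  have hsplit := Finset.add_sum_erase Finset.univ (fun k : Fin m => p k * ch k ^ 2) (Finset.mem_univ (a : Fin m))
  have hrest := Finset.sum_nonneg fun k (_ : k ∈ Finset.univ.erase (a : Fin m)) => hterm k
  linarith

/-- **JACOBI'S SIGNATURE RULE**: if no leading continuant vanishes, `ν(T_m)` = the number of NEGATIVE pivots and `π(T_m)` = the number of
POSITIVE pivots. [folklore: Jacobi / Sylvester] -/
theorem negIndex_eq_card_negPivots :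
    Fintype.card {j // (ctPathSymm_isHermitian L M m).eigenvalues j < 0} = Fintype.card {k : Fin m // p k < 0} ∧
    Fintype.card {j // 0 < (ctPathSymm_isHermitian L M m).eigenvalues j} = Fintype.card {k : Fin m // 0 < p k} := by
  classical
  have hneg := card_negPivots_le_negIndex L M m p hΔ hp
  have hpos := card_posPivots_le_posIndex L M m p hΔ hp
  have htot := negIndex_add_posIndex_add_corank (ctPathSymm_isHermitian L M m)
  have hcor : Fintype.card (Fin m) - (ctPath L M (fun t => M (t - 1)) m).rank = 0 :=
    corank_eq_zero_of_det_ne_zero (by rw [det_ctPathSymm]; exact hΔ m le_rfl)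
  -- every pivot is negative or positive
  have hcompl : Fintype.card {k : Fin m // 0 < p k} = Fintype.card {k : Fin m // ¬ (p k < 0)} := by
    refine Fintype.card_congr (Equiv.subtypeEquivRight fun k => ?_)
    constructor
    · intro h; exact not_lt.mpr h.le
    · intro h; exact lt_of_le_of_ne (not_lt.mp h) (pivot_ne_zero L M m p hΔ hp k k.isLt).symm
  have hsum : Fintype.card {k : Fin m // p k < 0} + Fintype.card {k : Fin m // 0 < p k} = m := by
    rw [hcompl, Fintype.card_subtype_compl, Fintype.card_fin]
    have := Fintype.card_subtype_le fun k : Fin m => p k < 0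
    rw [Fintype.card_fin] at this
    omega
  rw [hcor, Fintype.card_fin] at htot
  constructor <;> omega

/-- **JACOBI'S RULE IN STURM FORM**: `ν(T_m) = #{k < m : Δ_k · Δ_{k+1} < 0}` — the number of negative eigenvalues of the symmetric path
matrix is the number of SIGN CHANGES along its leading continuants `(Δ_0, …, Δ_m)` (none of which vanishes). [folklore: Jacobi / Sturm] -/
theorem negIndex_eq_card_signChanges :
    Fintype.card {j // (ctPathSymm_isHermitian L M m).eigenvalues j < 0} =
      (Finset.univ.filter fun k : Fin m =>
        ctK L (fun t => -M t) (fun t => M (t - 1)) k * ctK L (fun t => -M t) (fun t => M (t - 1)) (k + 1) < 0).card := by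
  classical
  rw [(negIndex_eq_card_negPivots L M m p hΔ hp).1, Fintype.card_subtype]
  congr 1
  refine Finset.filter_congr fun k _ => ?_
  have hk := hΔ k k.isLt.le
  have e := hp k k.isLt
  -- `p k < 0 ↔ Δ_k Δ_{k+1} < 0` since `p k Δ_k = Δ_{k+1}` and `Δ_k ≠ 0`
  have hsq : 0 < ctK L (fun t => -M t) (fun t => M (t - 1)) k ^ 2 := pow_pos (abs_pos.mpr hk) 2 |>.trans_eq (sq_abs _)
  rw [← e, show ctK L (fun t => -M t) (fun t => M (t - 1)) k * (p k * ctK L (fun t => -M t) (fun t => M (t - 1)) k) =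
    p k * ctK L (fun t => -M t) (fun t => M (t - 1)) k ^ 2 by ring]
  constructor
  · intro h; exact mul_neg_of_neg_of_pos h hsq
  · intro h
    by_contra hcon
    exact absurd h (not_lt.mpr (mul_nonneg (not_lt.mp hcon) hsq.le))

end Factor

/-! ## 4. User form: only the non-vanishing of the leading continuants is assumed -/
/-- **JACOBI–STURM RULE, hypothesis-minimal form**: no leading continuant vanishes ⇒ `ν(T_m) = #{k < m : Δ_k · Δ_{k+1} < 0}`. [folklore] -/
theorem negIndex_eq_card_signChanges' (m : ℕ)
    (hΔ : ∀ k, k ≤ m → ctK L (fun t => -M t) (fun t => M (t - 1)) k ≠ 0) :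
    Fintype.card {j // (ctPathSymm_isHermitian L M m).eigenvalues j < 0} =
      (Finset.univ.filter fun k : Fin m =>
        ctK L (fun t => -M t) (fun t => M (t - 1)) k * ctK L (fun t => -M t) (fun t => M (t - 1)) (k + 1) < 0).card :=
  negIndex_eq_card_signChanges L M m
    (fun k => ctK L (fun t => -M t) (fun t => M (t - 1)) (k + 1) / ctK L (fun t => -M t) (fun t => M (t - 1)) k) hΔ
    (fun k hk => div_mul_cancel₀ _ (hΔ k hk.le))

end SturmJacobi

end Summit.ValiantsHypothesis.ValiantsHypothesis.Theorems.KPlusLogSqLaw
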